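import Mathlib
import HarnessLib
import Literature.Geometry.Lorentzian.InverseMeanCurvatureFlowWeakGradient

/-!
# Route `IntegerScrew` — two comparison facts for finite matrix semigroups `e^{tA}`:
# (A) the FEYNMAN–KAC SANDWICH `e^{d₋t}(e^{tQ})_{ij} ≤ (e^{t(Q+D)})_{ij} ≤ e^{d₊t}(e^{tQ})_{ij}` for a Metzler
# generator `Q` and a diagonal potential `d₋ ≤ D ≤ d₊`; (B) SPECTRAL MONOTONICITY of the diagonal of `e^{tS}`
# for symmetric `S` with `cᵀSc ≤ λ‖c‖²`: `0 ≤ (e^{(t+u)S})_{ii} ≤ e^{λt}(e^{uS})_{ii}` (PIVOT-LAW 13.45's inputs)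

THEOREM N6₁ (PIVOT-LAW 13.45, rh-explicit A6-PIVOT theory) turns THEOREM C♯ (the return law of the pure walk
`p⁰₁₁ = (e^{tℒ})₁₁`) into the asymptotics of the window floor `1/f_M(L+s) = ∫₀^∞e^{−(s+γ₀)t}p^E₁₁(t)dt`,
`p^E₁₁ = (e^{t(ℒ+ℰ)})₁₁`, through two elementary comparison facts, proved here as generic finite-dimensional
analysis (real matrices over a finite index type):

* (A) `exp_smul_apply_le_exp_smul_add_diagonal_apply` — if `Q` is METZLER (`Q_{ij} ≥ 0`, `i ≠ j`) and `δ ≥ 0`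
  then `(e^{tQ})_{ij} ≤ (e^{t(Q + diag δ)})_{ij}` (`t ≥ 0`); hence the sandwich
  `exp_smul_add_diagonal_apply_ge` / `exp_smul_add_diagonal_apply_le`:
  `e^{d₋t}(e^{tQ})_{ij} ≤ (e^{t(Q + diag d)})_{ij} ≤ e^{d₊t}(e^{tQ})_{ij}` when `d₋ ≤ d ≤ d₊` — 13.45's
  «Feynman–Kac sandwich `e^{−0.19t}p⁰₁₁ ≤ p^E₁₁ ≤ e^{γ₀t}p⁰₁₁`» (`ε(y) ∈ [γ₀ − E₁, γ₀]`).  Proof: shift to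
  entrywise non-negative matrices, compare the exponential SERIES termwise.
* (B) `exp_smul_apply_self_eq_sum_sq` — for symmetric `S`, `(e^{tS})_{ii} = ‖e^{(t/2)S}e_i‖² ≥ 0`;
  `exp_add_smul_apply_self_le` — if moreover `cᵀSc ≤ λ‖c‖²` for all `c` then
  `(e^{(t+u)S})_{ii} ≤ e^{λt}(e^{uS})_{ii}` (`t, u ≥ 0`), in particular `(e^{tS})_{ii} ≤ e^{λt}` — the
  spectral bound 13.45 uses for the tail `t ≥ 1` with PROP. N2's `λ = ν_max(N_M) ≤ log M − γ₀ + o(1)`.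
  Proof without the spectral theorem: `s ↦ e^{−2λs}‖e^{sS}v‖²` is non-increasing (its derivative is
  `2e^{−2λs}(wᵀSw − λ‖w‖²) ≤ 0`, `w = e^{sS}v`).

RH-free and walk-free; nothing here bears on the truth of RH.  References: PIVOT-LAW §13.10, §13.45
(rh-explicit A6-PIVOT); M. Suzuki, J. Lond. Math. Soc. (2) 108 (2023) 1448–1487 [Suzuki2023] for the screw
matrices whose pivot law this serves.
-/

noncomputable section

-- D-0017: `Summit.<S>.<S>.…` is the designed namespace of a single-problem summit.
set_option linter.dupNamespace false

namespace Summit.RiemannHypothesis.RiemannHypothesis.Theorems.IntegerScrew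

open scoped Matrix.Norms.Operator
open NormedSpace Matrix Finset

variable {ι : Type*} [Fintype ι] [DecidableEq ι]

/-! ### (A) Monotonicity of the exponential on entrywise non-negative matrices; the Feynman–Kac sandwich -/

/-- Powers are monotone on entrywise non-negative matrices: `0 ≤ P ≤ P'` entrywise ⇒ `0 ≤ Pⁿ ≤ P'ⁿ`
entrywise. -/
theorem pow_apply_nonneg_and_le_of_le {P P' : Matrix ι ι ℝ} (hP : ∀ i j, 0 ≤ P i j)
    (hle : ∀ i j, P i j ≤ P' i j) (n : ℕ) (i j : ι) :
    0 ≤ (P ^ n) i j ∧ (P ^ n) i j ≤ (P' ^ n) i j := by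
  induction n generalizing i j with
  | zero =>
    rw [pow_zero, pow_zero, one_apply]
    split_ifs <;> norm_num
  | succ n ih =>
    rw [pow_succ, pow_succ, mul_apply, mul_apply]
    refine ⟨Finset.sum_nonneg fun k _ => mul_nonneg (ih i k).1 (hP k j), ?_⟩
    refine Finset.sum_le_sum fun k _ => ?_
    have h1 := ih i k
    have h2 : 0 ≤ P' k j := (hP k j).trans (hle k j)
    calc (P ^ n) i k * P k j ≤ (P ^ n) i k * P' k j := mul_le_mul_of_nonneg_left (hle k j) h1.1
      _ ≤ (P' ^ n) i k * P' k j := mul_le_mul_of_nonneg_right h1.2 h2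

/-- The exponential is monotone on entrywise non-negative matrices: `0 ≤ P ≤ P'` entrywise ⇒
`(e^P)_{ij} ≤ (e^{P'})_{ij}` (termwise comparison of the exponential series). -/
theorem exp_apply_le_exp_apply_of_le {P P' : Matrix ι ι ℝ} (hP : ∀ i j, 0 ≤ P i j)
    (hle : ∀ i j, P i j ≤ P' i j) (i j : ι) : (exp P) i j ≤ (exp P') i j := by
  let L : Matrix ι ι ℝ →L[ℝ] ℝ := LinearMap.toContinuousLinearMap (Matrix.entryLinearMap ℝ ℝ i j)
  have hL : ∀ A : Matrix ι ι ℝ, L A = A i j := fun A => rfl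
  have hterm : ∀ (A : Matrix ι ι ℝ) (n : ℕ),
      L ((Nat.factorial n : ℝ)⁻¹ • A ^ n) = (Nat.factorial n : ℝ)⁻¹ * (A ^ n) i j := fun A n =>
    (hL _).trans (by rw [Matrix.smul_apply, smul_eq_mul])
  have hsA : ∀ A : Matrix ι ι ℝ,
      HasSum (fun n : ℕ => (Nat.factorial n : ℝ)⁻¹ * (A ^ n) i j) ((exp A) i j) := by
    intro A
    have h := (NormedSpace.exp_series_hasSum_exp' (𝕂 := ℝ) A).map L L.continuous
    rw [hL] at h
    have e : (fun n : ℕ => (Nat.factorial n : ℝ)⁻¹ * (A ^ n) i j) =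
        (L : Matrix ι ι ℝ → ℝ) ∘ fun n : ℕ => (Nat.factorial n : ℝ)⁻¹ • A ^ n := by
      funext n
      exact (hterm A n).symm
    rw [e]
    exact h
  have hs := hsA P
  have hs' := hsA P'
  refine hasSum_le (fun n => ?_) hs hs'
  exact mul_le_mul_of_nonneg_left (pow_apply_nonneg_and_le_of_le hP hle n i j).2 (by positivity)

/-- **Adding a non-negative diagonal potential to a Metzler generator increases the semigroup entrywise**:
`Q_{ij} ≥ 0` (`i ≠ j`), `δ ≥ 0`, `t ≥ 0` ⇒ `(e^{tQ})_{ij} ≤ (e^{t(Q + diag δ)})_{ij}`. -/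
theorem exp_smul_apply_le_exp_smul_add_diagonal_apply {Q : Matrix ι ι ℝ}
    (hQ : ∀ i j, i ≠ j → 0 ≤ Q i j) {δ : ι → ℝ} (hδ : ∀ i, 0 ≤ δ i) {t : ℝ} (ht : 0 ≤ t) (i j : ι) :
    (exp (t • Q)) i j ≤ (exp (t • (Q + diagonal δ))) i j := by
  -- shift both matrices by μ·1, μ := Σ_k |Q_kk|, to make them entrywise non-negative
  set μ : ℝ := ∑ k, |Q k k| with hμ
  have hdiag : ∀ a, 0 ≤ Q a a + μ := fun a => by
    have h1 : |Q a a| ≤ μ := by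
      rw [hμ]
      exact Finset.single_le_sum (f := fun k => |Q k k|) (fun k _ => abs_nonneg _) (Finset.mem_univ a)
    have h2 : -Q a a ≤ |Q a a| := neg_le_abs _
    linarith
  set P : Matrix ι ι ℝ := t • (Q + μ • (1 : Matrix ι ι ℝ)) with hPdef
  set P' : Matrix ι ι ℝ := t • (Q + diagonal δ + μ • (1 : Matrix ι ι ℝ)) with hP'def
  have hP : ∀ a b, 0 ≤ P a b := by
    intro a b
    rw [hPdef, Matrix.smul_apply, smul_eq_mul, Matrix.add_apply, Matrix.smul_apply, smul_eq_mul,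
      Matrix.one_apply]
    refine mul_nonneg ht ?_
    by_cases hab : a = b
    · subst hab; rw [if_pos rfl, mul_one]; exact hdiag a
    · rw [if_neg hab, mul_zero, add_zero]; exact hQ a b hab
  have hle : ∀ a b, P a b ≤ P' a b := by
    intro a b
    rw [hPdef, hP'def, Matrix.smul_apply, Matrix.smul_apply, smul_eq_mul, smul_eq_mul]
    refine mul_le_mul_of_nonneg_left ?_ ht
    rw [Matrix.add_apply, Matrix.add_apply, Matrix.add_apply, diagonal_apply]
    by_cases hab : a = b
    · subst hab; rw [if_pos rfl]; linarith [hδ a]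
    · rw [if_neg hab, add_zero]
  have hmono := exp_apply_le_exp_apply_of_le hP hle i j
  -- undo the shift: exp(X + c·1) = e^c · exp X
  have hone : exp ((t * μ) • (1 : Matrix ι ι ℝ)) = Real.exp (t * μ) • (1 : Matrix ι ι ℝ) := by
    have h2 := NormedSpace.algebraMap_exp_comm (𝔸 := Matrix ι ι ℝ) (t * μ)
    simp only [Algebra.algebraMap_eq_smul_one] at h2
    rw [Real.exp_eq_exp_ℝ]
    convert h2.symm using 2 <;> rfl
  have hshift : ∀ X : Matrix ι ι ℝ, exp (t • (X + μ • (1 : Matrix ι ι ℝ))) = Real.exp (t * μ) • exp (t • X) := by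
    intro X
    have hc : Commute (t • X) ((t * μ) • (1 : Matrix ι ι ℝ)) := (Commute.one_right _).smul_right _
    rw [smul_add, smul_smul, Matrix.exp_add_of_commute _ _ hc, hone, Matrix.mul_smul, mul_one]
  rw [hPdef, hshift Q] at hmono
  rw [hP'def, hshift (Q + diagonal δ)] at hmono
  rw [Matrix.smul_apply, Matrix.smul_apply, smul_eq_mul, smul_eq_mul] at hmono
  exact le_of_mul_le_mul_left hmono (Real.exp_pos _)

/-- **Feynman–Kac sandwich, lower half**: `Q` Metzler, `d_i ≥ d₋` for all `i`, `t ≥ 0` ⇒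
`e^{d₋t}(e^{tQ})_{ij} ≤ (e^{t(Q + diag d)})_{ij}`. -/
theorem exp_smul_add_diagonal_apply_ge {Q : Matrix ι ι ℝ} (hQ : ∀ i j, i ≠ j → 0 ≤ Q i j)
    {d : ι → ℝ} {dlo : ℝ} (hd : ∀ i, dlo ≤ d i) {t : ℝ} (ht : 0 ≤ t) (i j : ι) :
    Real.exp (dlo * t) * (exp (t • Q)) i j ≤ (exp (t • (Q + diagonal d))) i j := by
  -- Q + diag d = (Q + d₋·1) + diag(d − d₋) with d − d₋ ≥ 0, and Q + d₋·1 is Metzler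
  have hQ' : ∀ a b, a ≠ b → 0 ≤ (Q + dlo • (1 : Matrix ι ι ℝ)) a b := fun a b hab => by
    rw [Matrix.add_apply, Matrix.smul_apply, Matrix.one_apply, if_neg hab, smul_zero, add_zero]
    exact hQ a b hab
  have h := exp_smul_apply_le_exp_smul_add_diagonal_apply hQ' (δ := fun k => d k - dlo)
    (fun k => sub_nonneg.2 (hd k)) ht i j
  have e1 : Q + dlo • (1 : Matrix ι ι ℝ) + diagonal (fun k => d k - dlo) = Q + diagonal d := by
    rw [smul_one_eq_diagonal, add_assoc, diagonal_add]
    congr 2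
    funext k
    simp
  rw [e1] at h
  have hone : exp ((t * dlo) • (1 : Matrix ι ι ℝ)) = Real.exp (t * dlo) • (1 : Matrix ι ι ℝ) := by
    have h2 := NormedSpace.algebraMap_exp_comm (𝔸 := Matrix ι ι ℝ) (t * dlo)
    simp only [Algebra.algebraMap_eq_smul_one] at h2
    rw [Real.exp_eq_exp_ℝ]
    convert h2.symm using 2 <;> rfl
  have hc : Commute (t • Q) ((t * dlo) • (1 : Matrix ι ι ℝ)) := (Commute.one_right _).smul_right _
  have hs : exp (t • (Q + dlo • (1 : Matrix ι ι ℝ))) = Real.exp (t * dlo) • exp (t • Q) := by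
    rw [smul_add, smul_smul, Matrix.exp_add_of_commute _ _ hc, hone, Matrix.mul_smul, mul_one]
  rw [hs, Matrix.smul_apply, smul_eq_mul, mul_comm t dlo] at h
  exact h

/-- **Feynman–Kac sandwich, upper half**: `Q` Metzler, `d_i ≤ d₊` for all `i`, `t ≥ 0` ⇒
`(e^{t(Q + diag d)})_{ij} ≤ e^{d₊t}(e^{tQ})_{ij}`. -/
theorem exp_smul_add_diagonal_apply_le {Q : Matrix ι ι ℝ} (hQ : ∀ i j, i ≠ j → 0 ≤ Q i j)
    {d : ι → ℝ} {dhi : ℝ} (hd : ∀ i, d i ≤ dhi) {t : ℝ} (ht : 0 ≤ t) (i j : ι) :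
    (exp (t • (Q + diagonal d))) i j ≤ Real.exp (dhi * t) * (exp (t • Q)) i j := by
  -- Q + diag d is Metzler; add diag(d₊ − d) ≥ 0 to reach Q + d₊·1
  have hQ' : ∀ a b, a ≠ b → 0 ≤ (Q + diagonal d) a b := fun a b hab => by
    rw [Matrix.add_apply, diagonal_apply, if_neg hab, add_zero]; exact hQ a b hab
  have h := exp_smul_apply_le_exp_smul_add_diagonal_apply hQ' (δ := fun k => dhi - d k)
    (fun k => sub_nonneg.2 (hd k)) ht i j
  have e1 : Q + diagonal d + diagonal (fun k => dhi - d k) = Q + dhi • (1 : Matrix ι ι ℝ) := by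
    rw [smul_one_eq_diagonal, add_assoc, diagonal_add]
    congr 2
    funext k
    simp
  rw [e1] at h
  have hone : exp ((t * dhi) • (1 : Matrix ι ι ℝ)) = Real.exp (t * dhi) • (1 : Matrix ι ι ℝ) := by
    have h2 := NormedSpace.algebraMap_exp_comm (𝔸 := Matrix ι ι ℝ) (t * dhi)
    simp only [Algebra.algebraMap_eq_smul_one] at h2
    rw [Real.exp_eq_exp_ℝ]
    convert h2.symm using 2 <;> rfl
  have hc : Commute (t • Q) ((t * dhi) • (1 : Matrix ι ι ℝ)) := (Commute.one_right _).smul_right _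
  have hs : exp (t • (Q + dhi • (1 : Matrix ι ι ℝ))) = Real.exp (t * dhi) • exp (t • Q) := by
    rw [smul_add, smul_smul, Matrix.exp_add_of_commute _ _ hc, hone, Matrix.mul_smul, mul_one]
  rw [hs, Matrix.smul_apply, smul_eq_mul, mul_comm t dhi] at h
  exact h

/-! ### (B) Symmetric generators: the diagonal of the semigroup is a sum of squares, and grows at most
like `e^{λt}` under a quadratic-form bound `cᵀSc ≤ λ‖c‖²` -/

/-- For a real symmetric `S`: `e^{tS}` is symmetric. -/
theorem exp_smul_transpose_of_isHermitian {S : Matrix ι ι ℝ} (hS : S.IsHermitian) (t : ℝ) :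
    (exp (t • S))ᵀ = exp (t • S) := by
  have hT : Sᵀ = S := by
    have h := hS.eq
    rwa [conjTranspose_eq_transpose_of_trivial] at h
  rw [← Matrix.exp_transpose, transpose_smul, hT]

/-- `e^{(t+u)S} = e^{tS}·e^{uS}`. -/
theorem exp_add_smul_eq_mul (S : Matrix ι ι ℝ) (t u : ℝ) :
    exp ((t + u) • S) = exp (t • S) * exp (u • S) := by
  rw [add_smul]
  exact Matrix.exp_add_of_commute _ _ ((Commute.refl S).smul_left t |>.smul_right u)

/-- For symmetric `S` and any vector `v`: `vᵀe^{2tS}v = ‖e^{tS}v‖²` (a sum of squares). -/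
theorem dotProduct_exp_smul_mulVec_eq_sum_sq {S : Matrix ι ι ℝ} (hS : S.IsHermitian) (t : ℝ)
    (v : ι → ℝ) :
    v ⬝ᵥ (exp ((t + t) • S) *ᵥ v) = ∑ k, ((exp (t • S) *ᵥ v) k) ^ 2 := by
  rw [exp_add_smul_eq_mul, ← mulVec_mulVec, dotProduct_mulVec, ← mulVec_transpose,
    exp_smul_transpose_of_isHermitian hS]
  simp only [dotProduct, pow_two]

/-- **The diagonal of a symmetric semigroup is a sum of squares**: `(e^{2tS})_{ii} = Σ_k (e^{tS})_{ki}²`. -/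
theorem exp_smul_apply_self_eq_sum_sq {S : Matrix ι ι ℝ} (hS : S.IsHermitian) (t : ℝ) (i : ι) :
    (exp ((t + t) • S)) i i = ∑ k, ((exp (t • S)) k i) ^ 2 := by
  have h := dotProduct_exp_smul_mulVec_eq_sum_sq hS t (Pi.single i 1)
  rw [single_dotProduct, one_mul, mulVec_single_one, mulVec_single_one] at h
  simp only [col_apply] at h
  exact h

/-- Hence the diagonal entries of `e^{tS}`, `S` symmetric, are non-negative (for every real `t`). -/
theorem exp_smul_apply_self_nonneg {S : Matrix ι ι ℝ} (hS : S.IsHermitian) (t : ℝ) (i : ι) :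
    0 ≤ (exp (t • S)) i i := by
  have e : t = t / 2 + t / 2 := by ring
  rw [e, exp_smul_apply_self_eq_sum_sq hS]
  exact Finset.sum_nonneg fun k _ => sq_nonneg _

/-- The coordinate `(e^{sS}v)_k` has derivative `(S·e^{sS}v)_k` in `s`. -/
theorem hasDerivAt_exp_smul_mulVec_apply (S : Matrix ι ι ℝ) (v : ι → ℝ) (k : ι) (s : ℝ) :
    HasDerivAt (fun r : ℝ => (exp (r • S) *ᵥ v) k) ((S *ᵥ (exp (s • S) *ᵥ v)) k) s := by
  have h := hasDerivAt_exp_smul_const' (𝕂 := ℝ) S s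
  let Lk : Matrix ι ι ℝ →ₗ[ℝ] ℝ :=
    { toFun := fun A => (A *ᵥ v) k
      map_add' := fun A B => by simp only [add_mulVec, Pi.add_apply]
      map_smul' := fun c A => by rw [smul_mulVec]; rfl }
  let L : Matrix ι ι ℝ →L[ℝ] ℝ := LinearMap.toContinuousLinearMap Lk
  have hL : ∀ A : Matrix ι ι ℝ, L A = (A *ᵥ v) k := fun A => rfl
  have h2 := L.hasFDerivAt.comp_hasDerivAt s h
  have hfun : (fun r : ℝ => (exp (r • S) *ᵥ v) k) = (L : Matrix ι ι ℝ → ℝ) ∘ fun r : ℝ => exp (r • S) := by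
    funext r
    simp only [Function.comp_apply, hL]
  rw [hfun]
  refine h2.congr_deriv ?_
  show L (S * exp (s • S)) = _
  rw [hL, mulVec_mulVec]

/-- `‖e^{sS}v‖²` has derivative `2·wᵀSw`, `w = e^{sS}v`. -/
theorem hasDerivAt_sum_sq_exp_smul_mulVec (S : Matrix ι ι ℝ) (v : ι → ℝ) (s : ℝ) :
    HasDerivAt (fun r : ℝ => ∑ k, ((exp (r • S) *ᵥ v) k) ^ 2)
      (2 * ((exp (s • S) *ᵥ v) ⬝ᵥ (S *ᵥ (exp (s • S) *ᵥ v)))) s := by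
  have h := HasDerivAt.fun_sum (u := Finset.univ)
    fun k _ => (hasDerivAt_exp_smul_mulVec_apply S v k s).pow 2
  simp only [Nat.cast_ofNat, Nat.add_one_sub_one, pow_one] at h
  refine h.congr_deriv ?_
  simp only [dotProduct, Finset.mul_sum]
  exact Finset.sum_congr rfl fun k _ => by ring

/-- Under the form bound `cᵀSc ≤ λ‖c‖²`, `s ↦ e^{−2λs}‖e^{sS}v‖²` is non-increasing (no symmetry needed). -/
theorem antitone_exp_mul_sum_sq {S : Matrix ι ι ℝ} {lam : ℝ}
    (hform : ∀ c : ι → ℝ, c ⬝ᵥ (S *ᵥ c) ≤ lam * (c ⬝ᵥ c)) (v : ι → ℝ) :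
    Antitone fun r : ℝ => Real.exp (-(2 * lam * r)) * ∑ k, ((exp (r • S) *ᵥ v) k) ^ 2 := by
  have hderiv : ∀ r : ℝ, HasDerivAt
      (fun r : ℝ => Real.exp (-(2 * lam * r)) * ∑ k, ((exp (r • S) *ᵥ v) k) ^ 2)
      (Real.exp (-(2 * lam * r)) * (-(2 * lam)) * ∑ k, ((exp (r • S) *ᵥ v) k) ^ 2 +
        Real.exp (-(2 * lam * r)) *
          (2 * ((exp (r • S) *ᵥ v) ⬝ᵥ (S *ᵥ (exp (r • S) *ᵥ v))))) r := by
    intro r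
    have h1 : HasDerivAt (fun r : ℝ => Real.exp (-(2 * lam * r))) (Real.exp (-(2 * lam * r)) * (-(2 * lam))) r := by
      have h := ((hasDerivAt_id r).const_mul (2 * lam)).neg.exp
      simpa using h
    exact h1.mul (hasDerivAt_sum_sq_exp_smul_mulVec S v r)
  refine antitone_of_deriv_nonpos (fun r => (hderiv r).differentiableAt) fun r => ?_
  rw [(hderiv r).deriv]
  set w : ι → ℝ := exp (r • S) *ᵥ v with hw
  have hsq : ∑ k, (w k) ^ 2 = w ⬝ᵥ w := by simp only [dotProduct, pow_two]
  rw [hsq]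
  have h := hform w
  have hpos := Real.exp_pos (-(2 * lam * r))
  nlinarith

/-- **Spectral monotonicity of the diagonal** (PIVOT-LAW 13.45's tail input): for a real symmetric `S`
with `cᵀSc ≤ λ‖c‖²` for all `c`, every `t ≥ 0`, every real `u` and every index `i`:
`(e^{(t+u)S})_{ii} ≤ e^{λt}·(e^{uS})_{ii}`. -/
theorem exp_add_smul_apply_self_le {S : Matrix ι ι ℝ} (hS : S.IsHermitian) {lam : ℝ}
    (hform : ∀ c : ι → ℝ, c ⬝ᵥ (S *ᵥ c) ≤ lam * (c ⬝ᵥ c)) {t : ℝ} (ht : 0 ≤ t) (u : ℝ) (i : ι) :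
    (exp ((t + u) • S)) i i ≤ Real.exp (lam * t) * (exp (u • S)) i i := by
  have hanti := antitone_exp_mul_sum_sq hform (Pi.single i 1)
    (show u / 2 ≤ (t + u) / 2 by linarith)
  simp only [mulVec_single_one, col_apply] at hanti
  have e1 : (exp ((t + u) • S)) i i = ∑ k, ((exp (((t + u) / 2) • S)) k i) ^ 2 := by
    have h := exp_smul_apply_self_eq_sum_sq hS ((t + u) / 2) i
    rwa [show (t + u) / 2 + (t + u) / 2 = t + u by ring] at h
  have e2 : (exp (u • S)) i i = ∑ k, ((exp ((u / 2) • S)) k i) ^ 2 := by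
    have h := exp_smul_apply_self_eq_sum_sq hS (u / 2) i
    rwa [show u / 2 + u / 2 = u by ring] at h
  rw [← e1, ← e2] at hanti
  -- e^{−λ(t+u)}·(e^{(t+u)S})ᵢᵢ ≤ e^{−λu}·(e^{uS})ᵢᵢ
  have hpos := Real.exp_pos (lam * (t + u))
  have h3 : Real.exp (lam * (t + u)) * (Real.exp (-(2 * lam * ((t + u) / 2))) * (exp ((t + u) • S)) i i)
      = (exp ((t + u) • S)) i i := by
    rw [← mul_assoc, ← Real.exp_add]; ring_nf; rw [Real.exp_zero, one_mul]
  have h4 : Real.exp (lam * (t + u)) * (Real.exp (-(2 * lam * (u / 2))) * (exp (u • S)) i i)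
      = Real.exp (lam * t) * (exp (u • S)) i i := by
    rw [← mul_assoc, ← Real.exp_add]; ring_nf
  rw [← h3, ← h4]
  exact mul_le_mul_of_nonneg_left hanti hpos.le

/-- In particular `(e^{tS})_{ii} ≤ e^{λt}` for `t ≥ 0`. -/
theorem exp_smul_apply_self_le_exp {S : Matrix ι ι ℝ} (hS : S.IsHermitian) {lam : ℝ}
    (hform : ∀ c : ι → ℝ, c ⬝ᵥ (S *ᵥ c) ≤ lam * (c ⬝ᵥ c)) {t : ℝ} (ht : 0 ≤ t) (i : ι) :
    (exp (t • S)) i i ≤ Real.exp (lam * t) := by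
  have h := exp_add_smul_apply_self_le hS hform ht 0 i
  rwa [add_zero, zero_smul, NormedSpace.exp_zero, one_apply_eq, mul_one] at h

end Summit.RiemannHypothesis.RiemannHypothesis.Theorems.IntegerScrew

end
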